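import Summits.QuantumAdvantage.QuantumAdvantage.Theorems.CharDialTokenDialA
import Summits.QuantumAdvantage.QuantumAdvantage.Theorems.CharDialTowerDefs
import Mathlib.Analysis.SpecificLimits.Normed
import HarnessLib

/-!
# CharDial tower — the TOKEN DIAL, part B: the dial theorem and the sixth escape clause (item vocabulary, Theses-free)

Cell `decomp-qadv`, lens 6, generation 19; supports stmt-QuantumAdvantage-27206 (`JLinLowResidual5`) and 27207
(`JLinResidualHigh5`).  This module has NO import path to `Theses.CharDial` (imports: part A, `CharDialTowerDefs`).

* `TowerDefs.TokenHyp D` — the TOKEN DIAL hypothesis on a junta ⊕ form presentation: a DEAD adjacent pair `(s, s+1)`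
  (`a_g(s) = a_g(s+1)`, `s, s+1 ∉ J_g` for every cut `g`) whose in-between cut `s+1` accepts at least `2ⁿ/(4p)` inputs of
  the swap set `{u_s ≠ u_{s+1}}`.
* ★ `token_hard (p) (p ≠ 3)`: eventually in `n`, every `log₂ n`-junta presentation meeting `TokenHyp` wins on at most
  `(1 − 1/(24p))·2ⁿ` inputs, every residue `c` — the SIXTH DECIDED DIAL (engine: part A; asymptotics: `n·cos(π/(3p))ⁿ → 0`).
* `TowerDefs.LowResidual6Side B` / `ResidualHigh6Side B` / `Residual6Side` — the five-dial residual classes with the sixth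
  escape clause `¬ TokenHyp D`; ★ `lowResidual5_iff_lowResidual6`, `residualHigh5_iff_residualHigh6`, `residual5_iff_residual6`:
  since the token dial is PROVED, each five-dial piece is EQUIVALENT to its six-dial residual (junction by name, every `B`).

WHAT THIS IS NOT: a proof of either residual piece; nothing about adjacencies of positive sensitivity.  0 sorry.
-/

set_option autoImplicit false

open Finset

namespace Summit.QuantumAdvantage.AdviceFreeQNC0.JLinPeel

namespace TowerDefs

variable {p n : ℕ}

/-- **the TOKEN DIAL hypothesis** on a presentation: some adjacent pair `(s, t = s+1)` is DEAD for every cut (equal form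
coefficients, outside every junta) and the cut numbered `t` accepts at least `2ⁿ/(4p)` inputs with `u_s ≠ u_t`. -/
def TokenHyp (D : JLinPeel.JLinData p n) : Prop :=
  ∃ s t : Fin n, t.val = s.val + 1 ∧ (∀ g, D.a g s = D.a g t ∧ s ∉ D.J g ∧ t ∉ D.J g) ∧
    2 ^ n ≤ 4 * p * (Finset.univ.filter fun u : Fin n → Bool =>
      u s ≠ u t ∧ D.strat ⟨t.val, Nat.lt_succ_of_lt t.isLt⟩ u = true).card

/-- **piece RESIDUAL-HIGH⁶.** `ResidualHigh5Side` with the sixth escape clause `¬ TokenHyp`. -/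
def ResidualHigh6Side (B : ℕ → ℕ) : Prop :=
  ∀ (p : ℕ) [Fact p.Prime], 5 ≤ p → ∃ θ : ℝ, θ < 1 ∧ ∃ n₀ : ℕ, ∀ n ≥ n₀, ∀ c : ℕ,
    ∀ y : Fin (n + 1) → (Fin n → Bool) → Bool, JLinHyp p n y → ¬ LowVar B n y →
      (∀ D : JLinPeel.JLinData p n, D.strat = y → (∀ g, (D.J g).card ≤ Nat.log 2 n) →
          ¬ SpanHyp D ∧ ¬ SparseHyp D ∧ ¬ BlockHyp D ∧ ¬ NullHyp D ∧ ¬ MaskHyp D ∧ ¬ TokenHyp D) →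
        ((Finset.univ.filter fun u : Fin n → Bool => ringWinU c y u = true).card : ℝ) ≤ θ * (2 : ℝ) ^ n

/-- **piece LOW-RESIDUAL⁶.** `LowResidual5Side` with the sixth escape clause `¬ TokenHyp`. -/
def LowResidual6Side (B : ℕ → ℕ) : Prop :=
  ∀ (p : ℕ) [Fact p.Prime], 5 ≤ p → ∃ θ : ℝ, θ < 1 ∧ ∃ n₀ : ℕ, ∀ n ≥ n₀, ∀ c : ℕ,
    ∀ y : Fin (n + 1) → (Fin n → Bool) → Bool, JLinHyp p n y → LowVar B n y →
      (∀ D : JLinPeel.JLinData p n, D.strat = y → (∀ g, (D.J g).card ≤ Nat.log 2 n) →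
          ¬ SpanHyp D ∧ ¬ SparseHyp D ∧ ¬ BlockHyp D ∧ ¬ NullHyp D ∧ ¬ MaskHyp D ∧ ¬ TokenHyp D) →
        ((Finset.univ.filter fun u : Fin n → Bool => ringWinU c y u = true).card : ℝ) ≤ θ * (2 : ℝ) ^ n

/-- **the SIX-DIAL RESIDUAL of T** (no variation condition). -/
def Residual6Side : Prop :=
  ∀ (p : ℕ) [Fact p.Prime], 5 ≤ p → ∃ θ : ℝ, θ < 1 ∧ ∃ n₀ : ℕ, ∀ n ≥ n₀, ∀ c : ℕ,
    ∀ y : Fin (n + 1) → (Fin n → Bool) → Bool, JLinHyp p n y →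
      (∀ D : JLinPeel.JLinData p n, D.strat = y → (∀ g, (D.J g).card ≤ Nat.log 2 n) →
          ¬ SpanHyp D ∧ ¬ SparseHyp D ∧ ¬ BlockHyp D ∧ ¬ NullHyp D ∧ ¬ MaskHyp D ∧ ¬ TokenHyp D) →
        ((Finset.univ.filter fun u : Fin n → Bool => ringWinU c y u = true).card : ℝ) ≤ θ * (2 : ℝ) ^ n

end TowerDefs

namespace TokenDial

variable {n : ℕ}

/-! ### the asymptotic input -/

/-- `0 ≤ cos(π/(3p)) < 1` for `p ≥ 1`. -/
theorem cos_facts {p : ℕ} (hp : 1 ≤ p) : 0 ≤ Real.cos (Real.pi / (3 * p)) ∧ Real.cos (Real.pi / (3 * p)) < 1 := by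
  have hpR : (1 : ℝ) ≤ p := by exact_mod_cast hp
  have h0 : 0 < Real.pi / (3 * p) := by positivity
  have h1 : Real.pi / (3 * p) ≤ Real.pi / 2 := by
    rw [div_le_div_iff₀ (by positivity) (by norm_num)]
    nlinarith [Real.pi_pos]
  refine ⟨Real.cos_nonneg_of_neg_pi_div_two_le_of_le (by linarith [Real.pi_pos]) h1, ?_⟩
  have h := Real.cos_lt_cos_of_nonneg_of_le_pi (le_refl 0) (by linarith [Real.pi_pos]) h0
  rwa [Real.cos_zero] at h

/-- **eventually `64p²·n·cos(π/(3p))ⁿ ≤ 1`.** -/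
theorem eventually_small (p : ℕ) (hp : 1 ≤ p) :
    ∃ n₀ : ℕ, ∀ n ≥ n₀, 64 * (p : ℝ) ^ 2 * n * Real.cos (Real.pi / (3 * p)) ^ n ≤ 1 := by
  obtain ⟨hc0, hc1⟩ := cos_facts hp
  have ht := tendsto_self_mul_const_pow_of_lt_one hc0 hc1
  have hε : (0 : ℝ) < 1 / (64 * (p : ℝ) ^ 2) := by
    have : (1 : ℝ) ≤ p := by exact_mod_cast hp
    positivity
  have hev := (ht.eventually (gt_mem_nhds hε))
  rw [Filter.eventually_atTop] at hev
  obtain ⟨n₀, hn₀⟩ := hev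
  refine ⟨n₀, fun n hn => ?_⟩
  have h := (hn₀ n hn).le
  have hp0 : (0 : ℝ) < 64 * (p : ℝ) ^ 2 := by
    have : (1 : ℝ) ≤ p := by exact_mod_cast hp
    positivity
  calc 64 * (p : ℝ) ^ 2 * n * Real.cos (Real.pi / (3 * p)) ^ n
      = 64 * (p : ℝ) ^ 2 * (n * Real.cos (Real.pi / (3 * p)) ^ n) := by ring
    _ ≤ 64 * (p : ℝ) ^ 2 * (1 / (64 * (p : ℝ) ^ 2)) := mul_le_mul_of_nonneg_left h hp0.le
    _ = 1 := by field_simp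

/-! ### the dial theorem -/

section Dial

variable {p : ℕ} [hp : Fact p.Prime]

/-- `2^{|J|} ≤ n` for a `log₂ n`-junta (`n ≥ 1`). -/
theorem two_pow_card_le {J : Finset (Fin n)} (hJ : J.card ≤ Nat.log 2 n) (hn : 1 ≤ n) : 2 ^ J.card ≤ n :=
  (Nat.pow_le_pow_right (by norm_num) hJ).trans (Nat.pow_log_le_self 2 (by omega))

/-- ★ **THE TOKEN DIAL (sixth decided dial).** for every prime `p ≠ 3`, eventually in `n`: a `log₂ n`-junta ⊕ form presentation
meeting `TokenHyp` wins on at most `(1 − 1/(24p))·2ⁿ` inputs, for every residue `c`. -/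
theorem token_hard (hp3 : p ≠ 3) : ∃ n₀ : ℕ, ∀ n ≥ n₀, ∀ (c : ℕ) (D : JLinPeel.JLinData p n),
    (∀ g, (D.J g).card ≤ Nat.log 2 n) → TowerDefs.TokenHyp D →
      ((univ.filter fun u : Fin n → Bool => ringWinU c D.strat u = true).card : ℝ)
        ≤ (1 - 1 / (24 * p)) * (2 : ℝ) ^ n := by
  have hp1 : 1 ≤ p := hp.out.one_lt.le
  obtain ⟨n₀, hn₀⟩ := eventually_small p hp1
  refine ⟨max n₀ 1, fun n hn c D hJ hT => ?_⟩
  have hn1 : 1 ≤ n := le_trans (le_max_right _ _) hn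
  obtain ⟨s, t, hst, hdead, hrich⟩ := hT
  have hE := engine hp3 c D s t hst hdead
  have hsmall := hn₀ n (le_trans (le_max_left _ _) hn)
  obtain ⟨hc0, -⟩ := cos_facts hp1
  have hpR : (1 : ℝ) ≤ p := by exact_mod_cast hp1
  -- the junta factor
  have hJn : ((2 : ℝ) ^ (D.J (cut t)).card) ≤ n := by exact_mod_cast two_pow_card_le (hJ (cut t)) hn1
  -- the richness, in ℝ (the cut index `⟨t.val, _⟩` of `TokenHyp` is `cut t` by `rfl`)
  have hR : (2 : ℝ) ^ n ≤ 4 * p * ((univ.filter fun u : Fin n → Bool => u s ≠ u t ∧ D.strat (cut t) u = true).card : ℝ) := by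
    exact_mod_cast hrich
  -- the error term: 8p·2^{|J|}·(2cos)ⁿ ≤ 2ⁿ/(8p)
  have hcn : 0 ≤ Real.cos (Real.pi / (3 * p)) ^ n := pow_nonneg hc0 n
  have herr : 8 * p * (2 : ℝ) ^ (D.J (cut t)).card * (2 * Real.cos (Real.pi / (3 * p))) ^ n
      ≤ (2 : ℝ) ^ n / (8 * p) := by
    rw [mul_pow, le_div_iff₀ (by positivity)]
    have h1 : 8 * p * (2 : ℝ) ^ (D.J (cut t)).card * (2 ^ n * Real.cos (Real.pi / (3 * p)) ^ n) * (8 * p)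
        = (64 * (p : ℝ) ^ 2 * (2 : ℝ) ^ (D.J (cut t)).card * Real.cos (Real.pi / (3 * p)) ^ n) * 2 ^ n := by ring
    rw [h1]
    have h2 : 64 * (p : ℝ) ^ 2 * (2 : ℝ) ^ (D.J (cut t)).card * Real.cos (Real.pi / (3 * p)) ^ n
        ≤ 64 * (p : ℝ) ^ 2 * n * Real.cos (Real.pi / (3 * p)) ^ n := by
      have : 0 ≤ 64 * (p : ℝ) ^ 2 := by positivity
      exact mul_le_mul_of_nonneg_right (mul_le_mul_of_nonneg_left hJn this) hcn
    have h3 : (0 : ℝ) ≤ 2 ^ n := by positivity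
    nlinarith
  have hp0 : (0 : ℝ) < p := by linarith
  have key : 3 * ((univ.filter fun u : Fin n → Bool => ringWinU c D.strat u = true).card : ℝ)
      ≤ 3 * (2 : ℝ) ^ n - (2 : ℝ) ^ n / (4 * p) + (2 : ℝ) ^ n / (8 * p) := by
    have h4 : (2 : ℝ) ^ n / (4 * p) ≤ ((univ.filter fun u : Fin n → Bool => u s ≠ u t ∧ D.strat (cut t) u = true).card : ℝ) := by
      rw [div_le_iff₀ (by positivity)]; linarith
    linarith
  have h5 : 3 * (2 : ℝ) ^ n - (2 : ℝ) ^ n / (4 * p) + (2 : ℝ) ^ n / (8 * p) = 3 * ((1 - 1 / (24 * p)) * (2 : ℝ) ^ n) := by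
    field_simp; ring
  linarith

end Dial

/-! ### the sixth escape clause: each five-dial piece is EQUIVALENT to its six-dial residual -/

section Junction

/-- class⁶ ⊆ class⁵: the six-dial escape hypothesis implies the five-dial one. -/
theorem residual6_of_residual5 : TowerDefs.Residual5Side → TowerDefs.Residual6Side := by
  intro h p _ hp5
  obtain ⟨θ, hθ, n₀, hn₀⟩ := h p hp5
  exact ⟨θ, hθ, n₀, fun n hn c y hy hesc => hn₀ n hn c y hy fun D hD hJ =>
    let ⟨h1, h2, h3, h4, h5, _⟩ := hesc D hD hJ; ⟨h1, h2, h3, h4, h5⟩⟩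

/-- the LOW⁵ side gives the LOW⁶ side (the token dial is decided: `token_hard`). -/
theorem lowResidual6_of_lowResidual5 (B : ℕ → ℕ) : TowerDefs.LowResidual5Side B → TowerDefs.LowResidual6Side B := by
  intro h p _ hp5
  obtain ⟨θ, hθ, n₀, hn₀⟩ := h p hp5
  exact ⟨θ, hθ, n₀, fun n hn c y hy hV hesc => hn₀ n hn c y hy hV fun D hD hJ =>
    let ⟨h1, h2, h3, h4, h5, _⟩ := hesc D hD hJ; ⟨h1, h2, h3, h4, h5⟩⟩

/-- the HIGH⁵ residual gives the HIGH⁶ residual (sixth escape clause absorbed by `absorb_token`). -/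
theorem residualHigh6_of_residualHigh5 (B : ℕ → ℕ) : TowerDefs.ResidualHigh5Side B → TowerDefs.ResidualHigh6Side B := by
  intro h p _ hp5
  obtain ⟨θ, hθ, n₀, hn₀⟩ := h p hp5
  exact ⟨θ, hθ, n₀, fun n hn c y hy hV hesc => hn₀ n hn c y hy hV fun D hD hJ =>
    let ⟨h1, h2, h3, h4, h5, _⟩ := hesc D hD hJ; ⟨h1, h2, h3, h4, h5⟩⟩

/-- **absorbing the token dial** (the common step): under a side condition `V` on the strategy, the six-dial residual piece gives
the five-dial piece, with `θ := max θ₆ (1 − 1/(24p))`. -/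
theorem absorb_token (V : (p n : ℕ) → (Fin (n + 1) → (Fin n → Bool) → Bool) → Prop)
    (h6 : ∀ (p : ℕ) [Fact p.Prime], 5 ≤ p → ∃ θ : ℝ, θ < 1 ∧ ∃ n₀ : ℕ, ∀ n ≥ n₀, ∀ c : ℕ,
      ∀ y : Fin (n + 1) → (Fin n → Bool) → Bool, TowerDefs.JLinHyp p n y → V p n y →
        (∀ D : JLinPeel.JLinData p n, D.strat = y → (∀ g, (D.J g).card ≤ Nat.log 2 n) →
            ¬ TowerDefs.SpanHyp D ∧ ¬ TowerDefs.SparseHyp D ∧ ¬ TowerDefs.BlockHyp D ∧ ¬ TowerDefs.NullHyp D ∧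
              ¬ TowerDefs.MaskHyp D ∧ ¬ TowerDefs.TokenHyp D) →
          ((Finset.univ.filter fun u : Fin n → Bool => ringWinU c y u = true).card : ℝ) ≤ θ * (2 : ℝ) ^ n) :
    ∀ (p : ℕ) [Fact p.Prime], 5 ≤ p → ∃ θ : ℝ, θ < 1 ∧ ∃ n₀ : ℕ, ∀ n ≥ n₀, ∀ c : ℕ,
      ∀ y : Fin (n + 1) → (Fin n → Bool) → Bool, TowerDefs.JLinHyp p n y → V p n y →
        (∀ D : JLinPeel.JLinData p n, D.strat = y → (∀ g, (D.J g).card ≤ Nat.log 2 n) →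
            ¬ TowerDefs.SpanHyp D ∧ ¬ TowerDefs.SparseHyp D ∧ ¬ TowerDefs.BlockHyp D ∧ ¬ TowerDefs.NullHyp D ∧
              ¬ TowerDefs.MaskHyp D) →
          ((Finset.univ.filter fun u : Fin n → Bool => ringWinU c y u = true).card : ℝ) ≤ θ * (2 : ℝ) ^ n := by
  intro p _ hp5
  have hp3 : p ≠ 3 := by omega
  obtain ⟨θ, hθ, n₆, hn₆⟩ := h6 p hp5
  obtain ⟨n₁, hn₁⟩ := token_hard (p := p) hp3
  have hpR : (0 : ℝ) < p := by exact_mod_cast (show 0 < p by omega)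
  have hθ' : (1 : ℝ) - 1 / (24 * p) < 1 := by
    have : (0 : ℝ) < 1 / (24 * p) := by positivity
    linarith
  refine ⟨max θ (1 - 1 / (24 * p)), max_lt hθ hθ', max n₆ n₁, fun n hn c y hy hV hesc => ?_⟩
  have h2n : (0 : ℝ) ≤ (2 : ℝ) ^ n := by positivity
  by_cases htok : ∃ D : JLinPeel.JLinData p n, D.strat = y ∧ (∀ g, (D.J g).card ≤ Nat.log 2 n) ∧ TowerDefs.TokenHyp D
  · obtain ⟨D, hD, hJ, hT⟩ := htok
    have h := hn₁ n (le_trans (le_max_right _ _) hn) c D hJ hT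
    rw [hD] at h
    exact h.trans (mul_le_mul_of_nonneg_right (le_max_right _ _) h2n)
  · push Not at htok
    have h := hn₆ n (le_trans (le_max_left _ _) hn) c y hy hV fun D hD hJ =>
      let ⟨h1, h2, h3, h4, h5⟩ := hesc D hD hJ; ⟨h1, h2, h3, h4, h5, htok D hD hJ⟩
    exact h.trans (mul_le_mul_of_nonneg_right (le_max_left _ _) h2n)

/-- ★ the six-dial residual gives the five-dial residual (token dial absorbed). -/
theorem residual5_of_residual6 : TowerDefs.Residual6Side → TowerDefs.Residual5Side := by
  intro h6
  have h := absorb_token (fun _ _ _ => True) (fun p _ hp5 => by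
    obtain ⟨θ, hθ, n₀, hn₀⟩ := h6 p hp5
    exact ⟨θ, hθ, n₀, fun n hn c y hy _ hesc => hn₀ n hn c y hy hesc⟩)
  intro p _ hp5
  obtain ⟨θ, hθ, n₀, hn₀⟩ := h p hp5
  exact ⟨θ, hθ, n₀, fun n hn c y hy hesc => hn₀ n hn c y hy trivial hesc⟩

/-- ★ LOW-RESIDUAL⁶ gives LOW-RESIDUAL⁵ (token dial absorbed), every schedule `B`. -/
theorem lowResidual5_of_lowResidual6 (B : ℕ → ℕ) : TowerDefs.LowResidual6Side B → TowerDefs.LowResidual5Side B :=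
  fun h6 => absorb_token (fun _ n y => TowerDefs.LowVar B n y) h6

/-- ★ RESIDUAL-HIGH⁶ gives RESIDUAL-HIGH⁵ (token dial absorbed), every schedule `B`. -/
theorem residualHigh5_of_residualHigh6 (B : ℕ → ℕ) : TowerDefs.ResidualHigh6Side B → TowerDefs.ResidualHigh5Side B :=
  fun h6 => absorb_token (fun _ n y => ¬ TowerDefs.LowVar B n y) h6

/-- ★★ **JUNCTION: LOW-RESIDUAL⁵ ⟺ LOW-RESIDUAL⁶** (item vocabulary; `stmt-QuantumAdvantage-27206` at `B = dialB`). -/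
theorem lowResidual5_iff_lowResidual6 (B : ℕ → ℕ) : TowerDefs.LowResidual5Side B ↔ TowerDefs.LowResidual6Side B :=
  ⟨lowResidual6_of_lowResidual5 B, lowResidual5_of_lowResidual6 B⟩

/-- ★★ **JUNCTION: RESIDUAL-HIGH⁵ ⟺ RESIDUAL-HIGH⁶** (item vocabulary; `stmt-QuantumAdvantage-27207` at `B = dialB`). -/
theorem residualHigh5_iff_residualHigh6 (B : ℕ → ℕ) : TowerDefs.ResidualHigh5Side B ↔ TowerDefs.ResidualHigh6Side B :=
  ⟨residualHigh6_of_residualHigh5 B, residualHigh5_of_residualHigh6 B⟩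

/-- ★★ **JUNCTION: RESIDUAL⁵ ⟺ RESIDUAL⁶.** -/
theorem residual5_iff_residual6 : TowerDefs.Residual5Side ↔ TowerDefs.Residual6Side :=
  ⟨residual6_of_residual5, residual5_of_residual6⟩

end Junction

end TokenDial

end Summit.QuantumAdvantage.AdviceFreeQNC0.JLinPeel
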